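import Literature.Geometry.Kaehler.ComplexTorusHypersurfaceClassPointCounts
import Literature.Geometry.Kaehler.ComplexTorusHypersurfaceStabilizerFinite
import HarnessLib

/-!
# Intersection number zero on a complex torus: no translate meets in an isolated point; a hypersurface has
# degree zero on a curve iff it is invariant under all differences of points of the curve, and then it is
# degenerate

Layer `Literature/Geometry/Kaehler`, namespace `Literature.Geometry.Kaehler.ComplexTorus`; lane
`lit-hodgefound`, seat p07 (generation 42), programme «NUMERICAL EQUIVALENCE», file 40. Sequel of file 39
(`ComplexTorusHypersurfaceClassPointCounts`: `∫_C [D]_e = sign(e) · #(C ∩ (D − t))` for almost every `t`),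
of file 5 (`ComplexTorusAnalyticIntersectionNumber`: Bézout for isolated points — the isolated points of
`Y₁ ∩ Y₂` number at most `(Y₁ · Y₂)`) and of file 33 (`ComplexTorusHypersurfaceStabilizerFinite`:
`{x | x + Y = Y}` is finite iff `(Y^g) ≠ 0`). Theorems only (no definition, no named fact; net debt `0`).

SETTING. `X = E/Λ` a compact complex torus of dimension `g`; `Y₁, Y₂ ⊆ X` closed analytic of complementary
pure dimensions `d₁ + d₂ = g`; `Y₂ − t = (· + t)⁻¹' Y₂`; a point `x ∈ Y₁ ∩ Y₂` is ISOLATED when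
`U ∩ (Y₁ ∩ Y₂) ⊆ {x}` for some neighbourhood `U` of `x` (the spelling of file 5). For a curve `C` (pure
dimension `1`) and a hypersurface `D` (pure dimension `q`, `g = q + 1`): `(D · C) = ∫_C [D]_e`
(`analyticCyclePeriod Φ hC [D]_e`; `= sign(e) · #(C ∩ (D − t))` for almost every `t`).

## Contents

* §1 **`wedge_analyticCycleClass_eq_zero_iff_forall_not_isolated`** — `[Y₁]_e ∧ [Y₂]_e = 0` iff NO translate
  `Y₂ − t` meets `Y₁` in an isolated point (Fulton §7.1 Prop. 7.1 (a) / §12.2: proper components carry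
  positive multiplicities; and a general translate meets in `(Y₁ · Y₂)` isolated points, Example 11.4.5);
  `analyticCyclePeriod_eq_zero_iff_wedge_eq_zero` (`(D · C) = 0 ⟺ [C]_e ∧ [D]_e = 0`).
* §2 CURVE AND HYPERSURFACE: **`analyticCyclePeriod_eq_zero_iff_forall_inter_translate`** — `(D · C) = 0` iff
  every translate `D − t` either misses `C` or contains it (a hypersurface section of an irreducible curve not
  inside the hypersurface is finite, Chirka §3.5 Prop. 3 / §5.3 Cor. 1, hence made of isolated points);
  **`analyticCyclePeriod_eq_zero_iff_forall_vadd_eq`** — `(D · C) = 0` iff `(c − c') + D = D` for all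
  `c, c' ∈ C`: THE HYPERSURFACE IS INVARIANT UNDER THE SUBGROUP GENERATED BY THE DIFFERENCES OF THE CURVE.
* §3 **`torusIntegral_wedgePow_eq_zero_of_analyticCyclePeriod_eq_zero`** — on ANY compact complex torus,
  `(D · C) = 0` for one irreducible curve `C` forces `(D^g) = 0` (the stabiliser `{x | x + D = D} ⊇ C − c₀`
  is infinite; file 33); equivalently `(D^g) ≠ 0 ⇒ (D · C) ≠ 0` for every irreducible curve (the half of
  Nakai–Moishezon on curves that holds on all tori, Hartshorne Thm. 5.1 `⇒`); and on an ABELIAN VARIETY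
  **`IsAbelianVariety.torusIntegral_wedgePow_eq_zero_iff_exists_curve_forall_vadd_eq`** — `(D^g) = 0` iff `D`
  is invariant under all differences of points of some irreducible curve (file 39: a degenerate hypersurface
  has a curve of degree `0`). On a general torus the converse of the first statement fails (`{0} × T` in
  `E × T` with `T` free of curves is degenerate of positive degree on every curve — file 34's remark).

## References

* [Fulton1998] W. Fulton, *Intersection Theory*, 2nd ed., Springer 1998, §7.1 Prop. 7.1 (a), §8.2 (8.8),
  Example 11.4.5, §12.2.
* [Chirka1989] E. M. Chirka, *Complex Analytic Sets*, Kluwer 1989, §3.5 Prop. 3 (p. 37), §5.3 Cor. 1 (p. 55),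
  §12.1 (p. 136).
* [Hartshorne1970] R. Hartshorne, *Ample Subvarieties of Algebraic Varieties*, LNM 156 (1970), Ch. I §5 Thm. 5.1.
* [Lange2023AbelianVarietiesComplex] H. Lange, *Abelian Varieties over the Complex Numbers*, Springer 2023,
  §2.1.1 Prop. 2.1.7, §2.1.3 Prop. 2.1.11, §4.6.2 Lemma 4.6.4.
-/

noncomputable section

open scoped Manifold Topology Pointwise
open MeasureTheory Set Function Filter Module

namespace Literature.Geometry.Kaehler

namespace ComplexTorus

universe u

variable {ι : Type*} [Fintype ι] [DecidableEq ι] {E : Type u} [NormedAddCommGroup E] [InnerProductSpace ℂ E]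
  [FiniteDimensional ℂ E] [MeasurableSpace E] [BorelSpace E] (Φ : (ι → ℝ) ≃L[ℝ] E)

omit [Fintype ι] [DecidableEq ι] [InnerProductSpace ℂ E] [FiniteDimensional ℂ E] [MeasurableSpace E]
  [BorelSpace E] in
/-- Reindexing along an equivalence of index types reflects `0`. [folklore] -/
private theorem eq_zero_of_domDomCongr_eq_zero {F : Type*} [NormedAddCommGroup F] [NormedSpace ℂ F]
    {k m : ℕ} (σ : Fin k ≃ Fin m) (θ : F [⋀^Fin k]→L[ℝ] ℂ) (h : θ.domDomCongr σ = 0) : θ = 0 := by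
  have h1 := congrArg (ContinuousAlternatingMap.domDomCongr σ.symm) h
  rwa [← ContinuousAlternatingMap.domDomCongr_trans, Equiv.self_trans_symm,
    ContinuousAlternatingMap.domDomCongr_refl, ContinuousAlternatingMap.domDomCongr_zero] at h1

omit [DecidableEq ι] [FiniteDimensional ℂ E] [MeasurableSpace E] [BorelSpace E] in
/-- Every point of a finite subset of the torus is isolated in it. [folklore] -/
private theorem exists_nhds_inter_subset_singleton_of_finite {S : Set (ComplexTorus Φ)} (hS : S.Finite)
    {x : ComplexTorus Φ} : ∃ U ∈ 𝓝 x, U ∩ S ⊆ {x} :=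
  ⟨(S \ {x})ᶜ, (hS.subset fun y hy ↦ hy.1).isClosed.isOpen_compl.mem_nhds (by simp), fun y hy ↦ by
    by_contra hyx; exact hy.1 ⟨hy.2, hyx⟩⟩

omit [DecidableEq ι] [MeasurableSpace E] [BorelSpace E] in
/-- A closed analytic subset of positive pure dimension is infinite (a finite non-empty analytic set has pure
dimension `0`, and the pure dimension is unique). [cite: Chirka1989, §2.3 (p. 23) and §12.1 (p. 136)] -/
private theorem infinite_of_hasPureDim_succ {Z : Set (ComplexTorus Φ)} {m : ℕ}
    (hZ : HasPureDim 𝓘(ℂ, E) Z (m + 1)) : Z.Infinite := by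
  intro hfin
  have h0 : HasPureDim 𝓘(ℂ, E) Z 0 := hasPureDim_zero_of_forall_isolated hZ.isAnalyticSet hZ.nonempty
    fun a _ ↦ exists_nhds_inter_subset_singleton_of_finite Φ hfin
  exact Nat.succ_ne_zero m (hasPureDim_unique Φ hZ h0)

/-! ### §1 `[Y₁] · [Y₂] = 0` iff no translate meets in an isolated point -/

section Isolated

variable {n d₁ d₂ p₁ p₂ : ℕ} (e : Fin n ≃ ι)

/-- **`[Y₁]_e ∧ [Y₂]_e = 0` iff no translate `Y₂ − t` meets `Y₁` in an isolated point** (complementary pure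
dimensions on a compact complex torus of positive dimension). `⇒`: the translate has the same class, and the
isolated points of `Y₁ ∩ (Y₂ − t)` number at most `(Y₁ · Y₂) = 0`
(`finite_isolated_and_ncard_le_of_wedge_eq_smul_volumeForm`); `⇐`: if the product is non-zero, a general
translate meets `Y₁` in finitely many and `(Y₁ · Y₂) ≥ 1` points, all isolated.
[cite: Fulton1998, §7.1 Prop. 7.1 (a), §8.2 (8.8), Example 11.4.5 and §12.2] -/
theorem wedge_analyticCycleClass_eq_zero_iff_forall_not_isolated (hE : 0 < finrank ℂ E)
    (hk₁ : 2 * d₁ + 2 * p₁ = n) (hk₂ : 2 * d₂ + 2 * p₂ = n) (h0 : 2 * 0 + 2 * (p₁ + p₂) = n)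
    {Y₁ Y₂ : Set (ComplexTorus Φ)} (hY₁ : HasPureDim 𝓘(ℂ, E) Y₁ d₁) (hY₂ : HasPureDim 𝓘(ℂ, E) Y₂ d₂) :
    (analyticCycleClass Φ e hk₁ hY₁).wedge (analyticCycleClass Φ e hk₂ hY₂) = 0 ↔
      ∀ (t x : ComplexTorus Φ), x ∈ Y₁ ∩ (fun y ↦ y + t) ⁻¹' Y₂ →
        ∀ U ∈ 𝓝 x, ¬ U ∩ (Y₁ ∩ (fun y ↦ y + t) ⁻¹' Y₂) ⊆ {x} := by
  constructor
  · intro hw t x hx U hU hsub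
    have hY₂' := hasPureDim_preimage_add_right Φ hY₂ t
    obtain ⟨hfin, hle⟩ := finite_isolated_and_ncard_le_of_wedge_eq_smul_volumeForm Φ e hE hk₁ hk₂ h0 hY₁ hY₂'
      (N := 0) (by
        rw [analyticCycleClass_preimage_add_right Φ e hk₂ hY₂ t, hw, ContinuousAlternatingMap.domDomCongr_zero,
          Nat.cast_zero]
        exact (zero_smul ℂ _).symm)
    have hempty := (Set.ncard_eq_zero hfin).1 (Nat.le_zero.1 hle)
    exact (Set.eq_empty_iff_forall_notMem.1 hempty) x ⟨hx, U, hU, hsub⟩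
  · intro h
    by_contra hw
    obtain ⟨t, hfin, ht⟩ :=
      (ae_finite_inter_translate_and_wedge_eq_ncard_smul_volumeForm Φ e hE hk₁ hk₂ h0 hY₁ hY₂).exists
    rcases (Y₁ ∩ (fun y ↦ y + t) ⁻¹' Y₂).eq_empty_or_nonempty with hS | ⟨x, hx⟩
    · rw [hS, Set.ncard_empty, Nat.cast_zero] at ht
      exact hw (eq_zero_of_domDomCongr_eq_zero _ _ (ht.trans (zero_smul ℂ _)))
    · obtain ⟨U, hU, hsub⟩ := exists_nhds_inter_subset_singleton_of_finite Φ hfin (x := x)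
      exact h t x hx U hU hsub

end Isolated

/-! ### §1' `(D · C) = 0 ⟺ [C] ∧ [D] = 0` -/

section CurveHypersurface

variable {g q : ℕ} (e : Fin (2 * g) ≃ ι)

/-- **`∫_C [D]_e = 0 ⟺ [C]_e ∧ [D]_e = 0`** for a curve `C` and a hypersurface `D` of a `g = q + 1`-dimensional
torus (the top form `[C] ∧ [D]` is `(∫_X [C] ∧ [D]) · vol = (sign(e) ∫_C [D]) · vol`). [cite: Fulton1998, §8.2 (8.8) and §12.2] -/
theorem analyticCyclePeriod_eq_zero_iff_wedge_eq_zero (hC' : 2 * 1 + 2 * q = 2 * g) (hD' : 2 * q + 2 * 1 = 2 * g)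
    {C D : Set (ComplexTorus Φ)} (hC : HasPureDim 𝓘(ℂ, E) C 1) (hD : HasPureDim 𝓘(ℂ, E) D q) :
    analyticCyclePeriod Φ hC (analyticCycleClass Φ e hD' hD) = 0 ↔
      (analyticCycleClass Φ e hC' hC).wedge (analyticCycleClass Φ e hD' hD) = 0 := by
  refine ⟨fun h ↦ ?_, analyticCyclePeriod_eq_zero_of_wedge_eq_zero Φ e hC' hD' hC hD⟩
  rw [← analyticCyclePeriod_analyticCycleClass_comm Φ e hC' hD' hC hD, ← poincarePairing_analyticCycleClass Φ e hD' hD,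
    ← torusIntegral_domDomCongr_wedge_eq_zero_iff Φ e hD'] at h
  refine eq_zero_of_domDomCongr_eq_zero (finCongr hD') _ ?_
  rw [eq_torusIntegral_smul_volumeForm Φ e
    (((analyticCycleClass Φ e hC' hC).wedge (analyticCycleClass Φ e hD' hD)).domDomCongr (finCongr hD')), h]
  exact zero_smul ℂ _

/-! ### §2 `(D · C) = 0` iff every translate of `D` misses `C` or contains it, iff `D + (c − c') = D` -/

/-- **`(D · C) = 0` iff every translate `D − t` either misses the irreducible curve `C` or contains it.**
`⇒`: a translate meeting `C` without containing it cuts it in a non-empty set of pure dimension `0` (Chirka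
§3.5 Prop. 3 / §5.3 Cor. 1 on the irreducible `C`), i.e. in isolated points — impossible by §1; `⇐`: almost
every translate meets `C` in finitely many points (file 39 §1), hence not in all of the infinite `C`, hence
not at all, and `∫_C [D] = sign(e) · 0`. [cite: Fulton1998, §7.1 Prop. 7.1 (a), Example 11.4.5 and §12.2]
[cite: Chirka1989, §3.5 Prop. 3 (p. 37) and §5.3 Cor. 1 (p. 55)] -/
theorem analyticCyclePeriod_eq_zero_iff_forall_inter_translate (hq : 1 + q = g) (hD' : 2 * q + 2 * 1 = 2 * g)
    {C D : Set (ComplexTorus Φ)} (hCi : IsIrreducibleAnalyticSet 𝓘(ℂ, E) C) (hC : HasPureDim 𝓘(ℂ, E) C 1)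
    (hD : HasPureDim 𝓘(ℂ, E) D q) :
    analyticCyclePeriod Φ hC (analyticCycleClass Φ e hD' hD) = 0 ↔
      ∀ t : ComplexTorus Φ, C ∩ (fun y ↦ y + t) ⁻¹' D = ∅ ∨ C ⊆ (fun y ↦ y + t) ⁻¹' D := by
  have hg : finrank ℂ E = g := finrank_eq_of_finTwoMulEquiv Φ e
  have hE : 0 < finrank ℂ E := by omega
  have hC' : 2 * 1 + 2 * q = 2 * g := by omega
  have h0 : 2 * 0 + 2 * (q + 1) = 2 * g := by omega
  have hq1 : q + 1 = finrank ℂ E := by omega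
  constructor
  · intro h t
    by_contra hnot
    push Not at hnot
    obtain ⟨hne, hnsub⟩ := hnot
    have hA := hasPureDim_preimage_add_right Φ hD t
    have hsec := (inter_eq_empty_or_hasPureDim_iff_not_subset_of_isIrreducible Φ hq1 hCi
      (show HasPureDim 𝓘(ℂ, E) C (0 + 1) from hC) hA).2 hnsub
    have hdim : HasPureDim 𝓘(ℂ, E) (C ∩ (fun y ↦ y + t) ⁻¹' D) 0 := hsec.resolve_left hne.ne_empty
    obtain ⟨x, hx⟩ := hdim.nonempty
    obtain ⟨U, hU, hsub⟩ := hdim.exists_nhds_inter_subset_singleton_of_zero hx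
    have hw := (analyticCyclePeriod_eq_zero_iff_wedge_eq_zero Φ e hC' hD' hC hD).1 h
    exact (wedge_analyticCycleClass_eq_zero_iff_forall_not_isolated Φ e hE hC' hD' h0 hC hD).1 hw t x hx U hU
      hsub
  · intro h
    obtain ⟨t, hfin, ht⟩ :=
      (ae_finite_and_analyticCyclePeriod_eq_orientationSign_mul_ncard Φ e hq hC' hD' hC hD).exists
    rcases h t with hempty | hsub
    · rw [ht, hempty, Set.ncard_empty, Nat.cast_zero, mul_zero]
    · exact absurd (hfin.subset fun y hy ↦ ⟨hy, hsub hy⟩) (infinite_of_hasPureDim_succ Φ hC)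

/-- **`(D · C) = 0` iff `D` is invariant under every difference of two points of the irreducible curve `C`:
`(c − c') + D = D` for all `c, c' ∈ C`.** (`⇒`: for `d ∈ D` the translate `D − (d − c')` meets `C` at `c'`,
hence contains `C`, i.e. `C + (d − c') ⊆ D`; `⇐`: a translate meeting `C` at `c₁` contains `c + t =
(c − c₁) + (c₁ + t) ∈ (c − c₁) + D = D`.) [cite: Fulton1998, Example 11.4.5 and §12.2]
[cite: Lange2023AbelianVarietiesComplex, §2.1.1 Prop. 2.1.7 and §2.1.3 Prop. 2.1.11] -/
theorem analyticCyclePeriod_eq_zero_iff_forall_vadd_eq (hq : 1 + q = g) (hD' : 2 * q + 2 * 1 = 2 * g)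
    {C D : Set (ComplexTorus Φ)} (hCi : IsIrreducibleAnalyticSet 𝓘(ℂ, E) C) (hC : HasPureDim 𝓘(ℂ, E) C 1)
    (hD : HasPureDim 𝓘(ℂ, E) D q) :
    analyticCyclePeriod Φ hC (analyticCycleClass Φ e hD' hD) = 0 ↔
      ∀ c ∈ C, ∀ c' ∈ C, (c - c') +ᵥ D = D := by
  rw [analyticCyclePeriod_eq_zero_iff_forall_inter_translate Φ e hq hD' hCi hC hD]
  -- `C + (d − c') ⊆ D` for all `d ∈ D`, `c' ∈ C`, from the translate alternative
  have key : (∀ t : ComplexTorus Φ, C ∩ (fun y ↦ y + t) ⁻¹' D = ∅ ∨ C ⊆ (fun y ↦ y + t) ⁻¹' D) →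
      ∀ c ∈ C, ∀ c' ∈ C, ∀ d ∈ D, c - c' + d ∈ D := by
    intro h c hc c' hc' d hd
    rcases h (d - c') with hempty | hsub
    · refine absurd ⟨hc', ?_⟩ (Set.eq_empty_iff_forall_notMem.1 hempty c')
      rw [mem_preimage, show c' + (d - c') = d by abel]
      exact hd
    · have h2 : c + (d - c') ∈ D := hsub hc
      rw [show c - c' + d = c + (d - c') by abel]
      exact h2
  constructor
  · intro h c hc c' hc'
    have h1 := key h
    ext x
    rw [Set.mem_vadd_set]
    constructor
    · rintro ⟨d, hd, rfl⟩
      rw [vadd_eq_add]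
      exact h1 c hc c' hc' d hd
    · intro hx
      refine ⟨c' - c + x, h1 c' hc' c hc x hx, ?_⟩
      rw [vadd_eq_add]; abel
  · intro h t
    by_cases hne : (C ∩ (fun y ↦ y + t) ⁻¹' D).Nonempty
    · right
      obtain ⟨c₁, hc₁, hc₁t⟩ := hne
      intro c hc
      rw [mem_preimage] at hc₁t ⊢
      have : c + t = (c - c₁) +ᵥ (c₁ + t) := by rw [vadd_eq_add]; abel
      rw [this, ← h c hc c₁ hc₁]
      exact Set.vadd_mem_vadd_set hc₁t
    · exact Or.inl (Set.not_nonempty_iff_eq_empty.1 hne)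

/-! ### §3 Degree zero on one curve forces degeneracy; on an abelian variety the converse -/

/-- **On ANY compact complex torus: if `(D · C) = 0` for ONE irreducible curve `C`, then `(D^g) = 0`** — the
stabiliser `{x | x + D = D}` contains `C − c₀`, an infinite set, while an ample hypersurface has finite
stabiliser (file 33 `finite_setOf_vadd_eq_iff_torusIntegral_wedgePow_ne_zero`). Contrapositive: `(D^g) ≠ 0 ⇒
(D · C) ≠ 0` for every irreducible curve — the half of the Nakai–Moishezon curve criterion valid on every torus.
[cite: Hartshorne1970, Ch. I §5 Thm. 5.1] [cite: Lange2023AbelianVarietiesComplex, §2.1.1 Prop. 2.1.7 and §2.1.3 Prop. 2.1.11] -/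
theorem torusIntegral_wedgePow_eq_zero_of_analyticCyclePeriod_eq_zero (hq : 1 + q = g)
    (hD' : 2 * q + 2 * 1 = 2 * g) {C D : Set (ComplexTorus Φ)} (hCi : IsIrreducibleAnalyticSet 𝓘(ℂ, E) C)
    (hC : HasPureDim 𝓘(ℂ, E) C 1) (hD : HasPureDim 𝓘(ℂ, E) D q)
    (h0 : analyticCyclePeriod Φ hC (analyticCycleClass Φ e hD' hD) = 0) :
    torusIntegral Φ e (wedgePow (analyticCycleClass Φ e hD' hD) g) = 0 := by
  by_contra hne
  have hfin := (finite_setOf_vadd_eq_iff_torusIntegral_wedgePow_ne_zero Φ e hD' hD).2 hne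
  have hinv := (analyticCyclePeriod_eq_zero_iff_forall_vadd_eq Φ e hq hD' hCi hC hD).1 h0
  obtain ⟨c₀, hc₀⟩ := hC.nonempty
  -- `c ↦ c − c₀` maps the infinite curve injectively into the finite stabiliser
  have hsub : (fun c ↦ c - c₀) '' C ⊆ {x : ComplexTorus Φ | x +ᵥ D = D} := by
    rintro _ ⟨c, hc, rfl⟩
    exact hinv c hc c₀ hc₀
  exact (infinite_of_hasPureDim_succ Φ hC) ((hfin.subset hsub).of_finite_image
    (sub_left_injective.injOn))

/-- Contrapositive: **`(D^g) ≠ 0 ⇒ (D · C) ≠ 0` for every irreducible curve, on every compact complex torus.**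
[cite: Hartshorne1970, Ch. I §5 Thm. 5.1] [cite: Fulton1998, Example 11.4.5 and §12.2] -/
theorem analyticCyclePeriod_ne_zero_of_torusIntegral_wedgePow_ne_zero (hq : 1 + q = g)
    (hD' : 2 * q + 2 * 1 = 2 * g) {C D : Set (ComplexTorus Φ)} (hCi : IsIrreducibleAnalyticSet 𝓘(ℂ, E) C)
    (hC : HasPureDim 𝓘(ℂ, E) C 1) (hD : HasPureDim 𝓘(ℂ, E) D q)
    (hDg : torusIntegral Φ e (wedgePow (analyticCycleClass Φ e hD' hD) g) ≠ 0) :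
    analyticCyclePeriod Φ hC (analyticCycleClass Φ e hD' hD) ≠ 0 :=
  fun h0 ↦ hDg (torusIntegral_wedgePow_eq_zero_of_analyticCyclePeriod_eq_zero Φ e hq hD' hCi hC hD h0)

/-- **An ample hypersurface is not invariant under all differences of a curve**: if `(D^g) ≠ 0` then for every
irreducible curve `C` some difference `c − c'` moves `D`. [cite: Lange2023AbelianVarietiesComplex, §2.1.1 Prop. 2.1.7 and §2.1.3 Prop. 2.1.11] -/
theorem exists_sub_vadd_ne_of_torusIntegral_wedgePow_ne_zero (hq : 1 + q = g) (hD' : 2 * q + 2 * 1 = 2 * g)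
    {C D : Set (ComplexTorus Φ)} (hCi : IsIrreducibleAnalyticSet 𝓘(ℂ, E) C) (hC : HasPureDim 𝓘(ℂ, E) C 1)
    (hD : HasPureDim 𝓘(ℂ, E) D q) (hDg : torusIntegral Φ e (wedgePow (analyticCycleClass Φ e hD' hD) g) ≠ 0) :
    ∃ c ∈ C, ∃ c' ∈ C, (c - c') +ᵥ D ≠ D := by
  by_contra h
  push Not at h
  exact analyticCyclePeriod_ne_zero_of_torusIntegral_wedgePow_ne_zero Φ e hq hD' hCi hC hD hDg
    ((analyticCyclePeriod_eq_zero_iff_forall_vadd_eq Φ e hq hD' hCi hC hD).2 h)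

/-- **On an abelian variety: `(D^g) = 0` iff `D` is invariant under all differences of points of some irreducible
curve** (`⇒`: a degenerate hypersurface has an irreducible curve of degree `0`, file 39
`IsAbelianVariety.exists_curve_ae_inter_translate_eq_empty_of_torusIntegral_wedgePow_eq_zero`; `⇐`: §3 on any
torus). [cite: Lange2023AbelianVarietiesComplex, §2.1.3 Prop. 2.1.11 and §4.6.2 Lemma 4.6.4] [cite: Hartshorne1970, Ch. I §5 Thm. 5.1] -/
theorem IsAbelianVariety.torusIntegral_wedgePow_eq_zero_iff_exists_curve_forall_vadd_eq (hX : IsAbelianVariety Φ)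
    (hq : 1 + q = g) (hD' : 2 * q + 2 * 1 = 2 * g) {D : Set (ComplexTorus Φ)} (hD : HasPureDim 𝓘(ℂ, E) D q) :
    torusIntegral Φ e (wedgePow (analyticCycleClass Φ e hD' hD) g) = 0 ↔
      ∃ (C : Set (ComplexTorus Φ)), IsIrreducibleAnalyticSet 𝓘(ℂ, E) C ∧ HasPureDim 𝓘(ℂ, E) C 1 ∧
        ∀ c ∈ C, ∀ c' ∈ C, (c - c') +ᵥ D = D := by
  constructor
  · intro hDg
    obtain ⟨C, hC, hCi, h0, -⟩ :=
      hX.exists_curve_ae_inter_translate_eq_empty_of_torusIntegral_wedgePow_eq_zero Φ e hq hD' hD hDg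
    exact ⟨C, hCi, hC, (analyticCyclePeriod_eq_zero_iff_forall_vadd_eq Φ e hq hD' hCi hC hD).1 h0⟩
  · rintro ⟨C, hCi, hC, h⟩
    exact torusIntegral_wedgePow_eq_zero_of_analyticCyclePeriod_eq_zero Φ e hq hD' hCi hC hD
      ((analyticCyclePeriod_eq_zero_iff_forall_vadd_eq Φ e hq hD' hCi hC hD).2 h)

/-- **On an abelian variety: `(D^g) ≠ 0` iff every irreducible curve has two points whose difference moves `D`.**
[cite: Lange2023AbelianVarietiesComplex, §2.1.3 Prop. 2.1.11 and §4.6.2 Lemma 4.6.4] [cite: Hartshorne1970, Ch. I §5 Thm. 5.1] -/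
theorem IsAbelianVariety.torusIntegral_wedgePow_ne_zero_iff_forall_curve_exists_sub_vadd_ne
    (hX : IsAbelianVariety Φ) (hq : 1 + q = g) (hD' : 2 * q + 2 * 1 = 2 * g) {D : Set (ComplexTorus Φ)}
    (hD : HasPureDim 𝓘(ℂ, E) D q) :
    torusIntegral Φ e (wedgePow (analyticCycleClass Φ e hD' hD) g) ≠ 0 ↔
      ∀ (C : Set (ComplexTorus Φ)), IsIrreducibleAnalyticSet 𝓘(ℂ, E) C → HasPureDim 𝓘(ℂ, E) C 1 →
        ∃ c ∈ C, ∃ c' ∈ C, (c - c') +ᵥ D ≠ D := by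
  rw [Ne, hX.torusIntegral_wedgePow_eq_zero_iff_exists_curve_forall_vadd_eq Φ e hq hD' hD]
  push Not
  rfl

end CurveHypersurface

end ComplexTorus

end Literature.Geometry.Kaehler

end
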